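import Summits.BirchSwinnertonDyer.BirchSwinnertonDyer.Theses.CMKolyvaginAtInertTwo
import Summits.BirchSwinnertonDyer.BirchSwinnertonDyer.Theorems.CMKolyvaginAtInertTwoLowerWitnessUpgradeAtTwo
import Summits.BirchSwinnertonDyer.BirchSwinnertonDyer.Theorems.GenusKolyvaginAtTwoPowDvdShaCardAtTwoRTBottomRungParity
import Summits.BirchSwinnertonDyer.BirchSwinnertonDyer.Theorems.CMKolyvaginAtInertTwoPairSupplyStubUpperAtTwo
import HarnessLib

/-! Scratch (bsd-line-cmk2-p1 g19): kernel check of a TURNKEY aside for crux 24277 `CMKolyvaginExactAtInertTwo` following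
KERNEL-STATUS §19: the LOWER half (`stub_lower`'s conclusion `2^{2M₀} ≤ #Ш(E_K)(2)`) on H₂ with PRIME `|d_K|`, as an
`…OfFacts`-shaped class aside on the route's four published inputs (items 24148, 19921, 19273, 24149) plus the named fact
`GrossLMS1991.prop37_2_reductionCongruence_inert` (Gross 1991 Prop. 3.7 (2)), closable BY NAME by this seat's
`KolyvaginLowerTwo.pow_le_card_primaryComponent_sha_two_baseChange_of_grossWitness_of_printedInputs` (file D1 = the H₂ port of gk2's
LINE 18 KS chain, files A–C2b).  Twin of g18's `TURNKEY_route_edit_24277_upper.lean`.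

THREE SHAPES are offered (the pen chooses; v2 adds L0 — NO restatement of the certificate needed any more):
(L0) `CMKolyvaginLowerAtInertTwoPrime` — 24277's statement VERBATIM (registered SHALLOW certificate: Zhang–Kolyvagin at `2` ∧ CM-inert,
     ANY index, `P(n) ∉ 2E(K[n])`) with ONLY `Nat.Prime |d_K|` and Gross 3.7 (2) by name inserted; conclusion the `≥` half.  Closed NOW
     by this seat's W-UP on H₂ (files W1–W4d, the all-Gross LEVEL-2 swap engine): `KolyvaginLowerTwo.stub_lower_of_prime_of_printedInputs`.
     Its EXACT twin `CMKolyvaginExactAtInertTwoPrime(OfFacts)` (= 24277 on prime `|d_K|` + prop37_2 + the four prints) is closed by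
     `le_antisymm` with g18's upper headline.
(L4) `CMKolyvaginLowerAtInertTwoPrimeDeep` — the certificate in LEVEL-4 GROSS currency (gk2's (β″) currency: `Squarefree n₀`, every
     `q ∣ n₀` Zhang–Kolyvagin at `2` with `2 ≤ kolyvaginIndex W 2 q` and `FrobEqFrobInfty W K (2^2) q`, a datum `e₀` with
     `addOrderOf (e₀.kolyvaginClass Nat.prime_two 2) = 2^2`).  Closed NOW (theorem below).
(L2) `CMKolyvaginLowerAtInertTwoPrimeDeep'` — the same with the witness in Kolyvagin's DIVISIBILITY currency `P(n₀) ∉ 2E(K[n₀])`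
     (24277's own `hPn` shape) at the same deep primes: closed NOW as well, by gk2's image-free single-datum conversion
     `RelaxedCount.addOrderOf_kolyvaginClass_two_eq_pow_of_not_two_dvd_single`.
(v1 said the shallow ⟹ deep passage was OPEN; v2: it is DONE on H₂ ∩ {|d_K| prime}, files W1–W4d.)  What remains outside: composite
`d_K` (Σ ≥ 2), the named fact `prop37_2_reductionCongruence_inert` (typer task), the four prints.  BSD is not proved by any of this;
nothing is asserted about the crux itself beyond these conditional theorems. -/

namespace Scratch.CMKolyvaginAtInertTwoEdit24277Lower

open Summit.BirchSwinnertonDyer.BirchSwinnertonDyer.Theses.CMKolyvaginAtInertTwo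
open Summit.BirchSwinnertonDyer.BirchSwinnertonDyer.Theorems

/-- PROPOSED aside text (L4): the LOWER HALF of 24277 on H₂ with prime `|d_K|`, level-4 Gross witness, modulo Gross 1991 Prop. 3.7 (2)
by name.  Binders of 24277 VERBATIM up to `hndiv` (incl. the two `¬ IsSquare` clauses, unused), then `Nat.Prime |d_K|` and the named fact
are inserted after the Heegner hypothesis, and the certificate `(n, d, hn, hKoly, hPn)` is replaced by the level-4 Gross witness. -/
def CMKolyvaginLowerAtInertTwoPrimeDeep : Prop :=
  ∀ (W : WeierstrassCurve ℚ) [W.IsElliptic] [W.IsGloballyMinimal] [NeZero (W.conductorNorm ℤ)], W.HasCM → Literature.NumberTheory.EllipticCurves.Rank1Residual.CMInert W 2 → W.HasSurjectiveModNGaloisRep (2 : ℤ) → Odd W.tamagawaProduct → ∀ (K : Type) [Field K] [NumberField K], Literature.NumberTheory.EllipticCurves.IsImaginaryQuadratic K → Odd (NumberField.discr K) → NumberField.discr K ≠ -3 → Nat.Prime (NumberField.discr K).natAbs → Literature.NumberTheory.EllipticCurves.SatisfiesHeegnerHypothesis (W.conductorNorm ℤ) K → Literature.NumberTheory.EllipticCurves.GrossLMS1991.prop37_2_reductionCongruence_inert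 (W.conductorNorm ℤ) W K → ¬ IsSquare ((NumberField.discr K : ℚ) * -|W.Δ|) → ¬ IsSquare ((NumberField.discr K : ℚ) * (-(2 * |W.Δ|))) → ∀ (Dt : Literature.NumberTheory.EllipticCurves.ModularForms.ModularParametrizationData W (W.conductorNorm ℤ)) (β : ℤ) (ι : K →+* ℂ) (d₁ : Literature.NumberTheory.EllipticCurves.KolyvaginHeegnerData Dt β ι 1), ¬ IsOfFinAddOrder d₁.derivedPoint → ∀ (M₀ : ℕ), (∃ Q : (W.baseChange (Literature.NumberTheory.EllipticCurves.ringClassField K ι 1)).toAffine.Point, ((2 ^ M₀ : ℕ) : ℤ) • Q = d₁.derivedPoint) → (¬ ∃ Q : (W.baseChange (Literature.NumberTheory.EllipticCurves.ringClassField K ι 1)).toAffine.Point, ((2 ^ (M₀ + 1) : ℕ) : ℤ) • Q = d₁.derivedPoint) → ∀ (n₀ : ℕ) (e₀ : Literature.NumberTheory.EllipticCurves.KolyvaginHeegnerData Dt β ι n₀), Squarefree n₀ → (∀ q ∈ n₀.primeFactors, Literature.NumberTheory.EllipticCurves.Zhang2014.IsKolyvaginPrime (W.conductorNorm ℤ)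 W K 2 q ∧ 2 ≤ Literature.NumberTheory.EllipticCurves.Zhang2014.kolyvaginIndex W 2 q ∧ Literature.NumberTheory.EllipticCurves.FrobEqFrobInfty W K (2 ^ 2) q) → addOrderOf (e₀.kolyvaginClass Nat.prime_two 2) = 2 ^ 2 → 2 ^ (2 * M₀) ≤ Nat.card (AddCommGroup.primaryComponent (W.baseChange K).sha 2)

/-- PROPOSED `…OfFacts` twin on the route's four published inputs (items 24148, 19921, 19273, 24149). -/
def CMKolyvaginLowerAtInertTwoPrimeDeepOfFacts : Prop :=
  ((∀ (N : ℕ) [NeZero N] (W : WeierstrassCurve ℚ) (K : Type) [Field K] [NumberField K],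
      Literature.NumberTheory.EllipticCurves.gross_zagier N W K) ∧
    Literature.NumberTheory.EllipticCurves.rank_eq_analyticRank_of_analyticRank_le_one ∧
    WeierstrassCurve.hasEntireLFunction_rat ∧
    Literature.NumberTheory.EllipticCurves.Milne1972.bsdQuotient_baseChange_quadratic_anyModel) →
  CMKolyvaginLowerAtInertTwoPrimeDeep

/-- THE CLOSER (kernel-checked here): the `…OfFacts` aside BY NAME from file D1. -/
theorem cmKolyvaginLowerAtInertTwoPrimeDeepOfFacts_proof : CMKolyvaginLowerAtInertTwoPrimeDeepOfFacts := by
  rintro ⟨hGZ, hGZK, hmod, hMi⟩ W _ _ _ hCM hin hρ hT K _ _ hK hodd h3 hq hH h372 _ _ Dt β ι d₁ hy M₀ hdiv hndiv n₀ e₀ hn₀ hn₀K he₀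
  have hρ2 : W.HasSurjectiveModNGaloisRep 2 := hρ
  exact KolyvaginLowerTwo.pow_le_card_primaryComponent_sha_two_baseChange_of_grossWitness_of_printedInputs hGZ hGZK hmod hMi W hCM
    hin hρ2 hT K hK hodd h3 hq hH h372 Dt β ι d₁ hy M₀ hdiv hndiv hn₀ hn₀K e₀ he₀

/-- PROPOSED aside text (L2): the same with the witness in DIVISIBILITY currency `P(n₀) ∉ 2E(K[n₀])` (24277's `hPn` shape) at deep Gross
primes — what 24277's certificate clause would read under the pen's (β″)-style restatement
«`… ∧ 2 ≤ kolyvaginIndex W 2 ℓ ∧ FrobEqFrobInfty W K (2^2) ℓ`». -/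
def CMKolyvaginLowerAtInertTwoPrimeDeep' : Prop :=
  ∀ (W : WeierstrassCurve ℚ) [W.IsElliptic] [W.IsGloballyMinimal] [NeZero (W.conductorNorm ℤ)], W.HasCM → Literature.NumberTheory.EllipticCurves.Rank1Residual.CMInert W 2 → W.HasSurjectiveModNGaloisRep (2 : ℤ) → Odd W.tamagawaProduct → ∀ (K : Type) [Field K] [NumberField K], Literature.NumberTheory.EllipticCurves.IsImaginaryQuadratic K → Odd (NumberField.discr K) → NumberField.discr K ≠ -3 → Nat.Prime (NumberField.discr K).natAbs → Literature.NumberTheory.EllipticCurves.SatisfiesHeegnerHypothesis (W.conductorNorm ℤ) K → Literature.NumberTheory.EllipticCurves.GrossLMS1991.prop37_2_reductionCongruence_inert (W.conductorNorm ℤ) W K → ¬ IsSquare ((NumberField.discr K : ℚ) * -|W.Δ|) → ¬ IsSquare ((NumberField.discr K : ℚ) * (-(2 * |W.Δ|))) → ∀ (Dt : Literature.NumberTheory.EllipticCurves.ModularForms.ModularParametrizationData W (W.conductorNorm ℤ)) (β : ℤ) (ι : K →+* ℂ) (d₁ : Literature.NumberTheory.EllipticCurves.KolyvaginHeegnerData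 Dt β ι 1), ¬ IsOfFinAddOrder d₁.derivedPoint → ∀ (M₀ : ℕ), (∃ Q : (W.baseChange (Literature.NumberTheory.EllipticCurves.ringClassField K ι 1)).toAffine.Point, ((2 ^ M₀ : ℕ) : ℤ) • Q = d₁.derivedPoint) → (¬ ∃ Q : (W.baseChange (Literature.NumberTheory.EllipticCurves.ringClassField K ι 1)).toAffine.Point, ((2 ^ (M₀ + 1) : ℕ) : ℤ) • Q = d₁.derivedPoint) → ∀ (n : ℕ) (d : Literature.NumberTheory.EllipticCurves.KolyvaginHeegnerData Dt β ι n), Squarefree n → (∀ ℓ ∈ n.primeFactors, (Literature.NumberTheory.EllipticCurves.Zhang2014.IsKolyvaginPrime (W.conductorNorm ℤ) W K 2 ℓ ∧ Literature.NumberTheory.EllipticCurves.Rank1Residual.CMInert W ℓ) ∧ 2 ≤ Literature.NumberTheory.EllipticCurves.Zhang2014.kolyvaginIndex W 2 ℓ ∧ Literature.NumberTheory.EllipticCurves.FrobEqFrobInfty W K (2 ^ 2) ℓ) → (¬ ∃ Q : (W.baseChange (Literature.NumberTheory.EllipticCurves.ringClassField K ι n)).toAffine.Point, (2 : ℤ)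 • Q = d.derivedPoint) → 2 ^ (2 * M₀) ≤ Nat.card (AddCommGroup.primaryComponent (W.baseChange K).sha 2)

/-- `…OfFacts` twin of (L2). -/
def CMKolyvaginLowerAtInertTwoPrimeDeep'OfFacts : Prop :=
  ((∀ (N : ℕ) [NeZero N] (W : WeierstrassCurve ℚ) (K : Type) [Field K] [NumberField K],
      Literature.NumberTheory.EllipticCurves.gross_zagier N W K) ∧
    Literature.NumberTheory.EllipticCurves.rank_eq_analyticRank_of_analyticRank_le_one ∧
    WeierstrassCurve.hasEntireLFunction_rat ∧
    Literature.NumberTheory.EllipticCurves.Milne1972.bsdQuotient_baseChange_quadratic_anyModel) →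
  CMKolyvaginLowerAtInertTwoPrimeDeep'

/-- THE CLOSER of (L2): divisibility currency ⟹ class currency by gk2's image-free
`RelaxedCount.addOrderOf_kolyvaginClass_two_eq_pow_of_not_two_dvd_single`, then (L4). -/
theorem cmKolyvaginLowerAtInertTwoPrimeDeep'OfFacts_proof : CMKolyvaginLowerAtInertTwoPrimeDeep'OfFacts := by
  rintro ⟨hGZ, hGZK, hmod, hMi⟩ W _ _ _ hCM hin hρ hT K _ _ hK hodd h3 hq hH h372 _ _ Dt β ι d₁ hy M₀ hdiv hndiv n d hn hKoly hPn
  have hρ2 : W.HasSurjectiveModNGaloisRep 2 := hρ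
  have hn₀K : ∀ q ∈ n.primeFactors, Literature.NumberTheory.EllipticCurves.Zhang2014.IsKolyvaginPrime (W.conductorNorm ℤ) W K 2 q ∧
      2 ≤ Literature.NumberTheory.EllipticCurves.Zhang2014.kolyvaginIndex W 2 q ∧
      Literature.NumberTheory.EllipticCurves.FrobEqFrobInfty W K (2 ^ 2) q :=
    fun q hq' ↦ ⟨(hKoly q hq').1.1, (hKoly q hq').2.1, (hKoly q hq').2.2⟩
  have he : addOrderOf (d.kolyvaginClass Nat.prime_two 2) = 2 ^ 2 :=
    GenusExact.RelaxedCount.addOrderOf_kolyvaginClass_two_eq_pow_of_not_two_dvd_single W hK hodd h3 hH hρ2 Dt β ι (M := 2)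
      (by norm_num) hn (fun q hq' ↦ ⟨(hn₀K q hq').1, (hn₀K q hq').2.1⟩) d hPn
  exact KolyvaginLowerTwo.pow_le_card_primaryComponent_sha_two_baseChange_of_grossWitness_of_printedInputs hGZ hGZK hmod hMi W hCM
    hin hρ2 hT K hK hodd h3 hq hH h372 Dt β ι d₁ hy M₀ hdiv hndiv hn hn₀K d he

/-- Sanity (the restated `stub_lower` shape): 24277's binders VERBATIM with the certificate clause STRENGTHENED à la (β″) imply the `≥`
half whenever `|d_K|` is prime and Prop. 3.7 (2) + the four facts are given. -/
theorem stub_lower_of_aside_of_prime (hA : CMKolyvaginLowerAtInertTwoPrimeDeep') :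
    ∀ (W : WeierstrassCurve ℚ) [W.IsElliptic] [W.IsGloballyMinimal] [NeZero (W.conductorNorm ℤ)], W.HasCM → Literature.NumberTheory.EllipticCurves.Rank1Residual.CMInert W 2 → W.HasSurjectiveModNGaloisRep (2 : ℤ) → Odd W.tamagawaProduct → ∀ (K : Type) [Field K] [NumberField K], Literature.NumberTheory.EllipticCurves.IsImaginaryQuadratic K → Odd (NumberField.discr K) → NumberField.discr K ≠ -3 → Literature.NumberTheory.EllipticCurves.SatisfiesHeegnerHypothesis (W.conductorNorm ℤ) K → ¬ IsSquare ((NumberField.discr K : ℚ) * -|W.Δ|) → ¬ IsSquare ((NumberField.discr K : ℚ) * (-(2 * |W.Δ|))) → ∀ (Dt : Literature.NumberTheory.EllipticCurves.ModularForms.ModularParametrizationData W (W.conductorNorm ℤ)) (β : ℤ) (ι : K →+* ℂ) (d₁ : Literature.NumberTheory.EllipticCurves.KolyvaginHeegnerData Dt β ι 1), ¬ IsOfFinAddOrder d₁.derivedPoint → ∀ (M₀ : ℕ), (∃ Q : (W.baseChange (Literature.NumberTheory.EllipticCurves.ringClassField K ι 1)).toAffine.Point, ((2 ^ M₀ : ℕ)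 : ℤ) • Q = d₁.derivedPoint) → (¬ ∃ Q : (W.baseChange (Literature.NumberTheory.EllipticCurves.ringClassField K ι 1)).toAffine.Point, ((2 ^ (M₀ + 1) : ℕ) : ℤ) • Q = d₁.derivedPoint) → ∀ (n : ℕ) (d : Literature.NumberTheory.EllipticCurves.KolyvaginHeegnerData Dt β ι n), Squarefree n → (∀ ℓ ∈ n.primeFactors, (Literature.NumberTheory.EllipticCurves.Zhang2014.IsKolyvaginPrime (W.conductorNorm ℤ) W K 2 ℓ ∧ Literature.NumberTheory.EllipticCurves.Rank1Residual.CMInert W ℓ) ∧ 2 ≤ Literature.NumberTheory.EllipticCurves.Zhang2014.kolyvaginIndex W 2 ℓ ∧ Literature.NumberTheory.EllipticCurves.FrobEqFrobInfty W K (2 ^ 2) ℓ) → (¬ ∃ Q : (W.baseChange (Literature.NumberTheory.EllipticCurves.ringClassField K ι n)).toAffine.Point, (2 : ℤ) • Q = d.derivedPoint) →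
      Nat.Prime (NumberField.discr K).natAbs →
      Literature.NumberTheory.EllipticCurves.GrossLMS1991.prop37_2_reductionCongruence_inert (W.conductorNorm ℤ) W K →
      2 ^ (2 * M₀) ≤ Nat.card (AddCommGroup.primaryComponent (W.baseChange K).sha 2) := by
  intro W _ _ _ hCM hin hρ hT K _ _ hK hodd h3 hH hs1 hs2 Dt β ι d₁ hy M₀ hdiv hndiv n d hn hKol hPn hq h372
  exact hA W hCM hin hρ hT K hK hodd h3 hq hH h372 hs1 hs2 Dt β ι d₁ hy M₀ hdiv hndiv n d hn hKol hPn

/-- PROPOSED exactness aside in (β″)-currency: 24277's statement with `Nat.Prime |d_K|` + Gross 3.7 (2) by name inserted and the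
certificate clause strengthened to deep Gross primes; conclusion `=`.  (The pen may instead RESTATE 24277 itself this way.) -/
def CMKolyvaginExactAtInertTwoPrimeDeep' : Prop :=
  ∀ (W : WeierstrassCurve ℚ) [W.IsElliptic] [W.IsGloballyMinimal] [NeZero (W.conductorNorm ℤ)], W.HasCM → Literature.NumberTheory.EllipticCurves.Rank1Residual.CMInert W 2 → W.HasSurjectiveModNGaloisRep (2 : ℤ) → Odd W.tamagawaProduct → ∀ (K : Type) [Field K] [NumberField K], Literature.NumberTheory.EllipticCurves.IsImaginaryQuadratic K → Odd (NumberField.discr K) → NumberField.discr K ≠ -3 → Nat.Prime (NumberField.discr K).natAbs → Literature.NumberTheory.EllipticCurves.SatisfiesHeegnerHypothesis (W.conductorNorm ℤ) K → Literature.NumberTheory.EllipticCurves.GrossLMS1991.prop37_2_reductionCongruence_inert (W.conductorNorm ℤ) W K → ¬ IsSquare ((NumberField.discr K : ℚ) * -|W.Δ|) → ¬ IsSquare ((NumberField.discr K : ℚ) * (-(2 * |W.Δ|))) → ∀ (Dt : Literature.NumberTheory.EllipticCurves.ModularForms.ModularParametrizationData W (W.conductorNorm ℤ)) (β : ℤ)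 (ι : K →+* ℂ) (d₁ : Literature.NumberTheory.EllipticCurves.KolyvaginHeegnerData Dt β ι 1), ¬ IsOfFinAddOrder d₁.derivedPoint → ∀ (M₀ : ℕ), (∃ Q : (W.baseChange (Literature.NumberTheory.EllipticCurves.ringClassField K ι 1)).toAffine.Point, ((2 ^ M₀ : ℕ) : ℤ) • Q = d₁.derivedPoint) → (¬ ∃ Q : (W.baseChange (Literature.NumberTheory.EllipticCurves.ringClassField K ι 1)).toAffine.Point, ((2 ^ (M₀ + 1) : ℕ) : ℤ) • Q = d₁.derivedPoint) → ∀ (n : ℕ) (d : Literature.NumberTheory.EllipticCurves.KolyvaginHeegnerData Dt β ι n), Squarefree n → (∀ ℓ ∈ n.primeFactors, (Literature.NumberTheory.EllipticCurves.Zhang2014.IsKolyvaginPrime (W.conductorNorm ℤ) W K 2 ℓ ∧ Literature.NumberTheory.EllipticCurves.Rank1Residual.CMInert W ℓ) ∧ 2 ≤ Literature.NumberTheory.EllipticCurves.Zhang2014.kolyvaginIndex W 2 ℓ ∧ Literature.NumberTheory.EllipticCurves.FrobEqFrobInfty W K (2 ^ 2) ℓ) → (¬ ∃ Q : (W.baseChange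 (Literature.NumberTheory.EllipticCurves.ringClassField K ι n)).toAffine.Point, (2 : ℤ) • Q = d.derivedPoint) → Nat.card (AddCommGroup.primaryComponent (W.baseChange K).sha 2) = 2 ^ (2 * M₀)

/-- `…OfFacts` twin of the exactness aside (the four published inputs as antecedent). -/
def CMKolyvaginExactAtInertTwoPrimeDeep'OfFacts : Prop :=
  ((∀ (N : ℕ) [NeZero N] (W : WeierstrassCurve ℚ) (K : Type) [Field K] [NumberField K],
      Literature.NumberTheory.EllipticCurves.gross_zagier N W K) ∧
    Literature.NumberTheory.EllipticCurves.rank_eq_analyticRank_of_analyticRank_le_one ∧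
    WeierstrassCurve.hasEntireLFunction_rat ∧
    Literature.NumberTheory.EllipticCurves.Milne1972.bsdQuotient_baseChange_quadratic_anyModel) →
  CMKolyvaginExactAtInertTwoPrimeDeep'

/-- THE CLOSER of the exactness aside (kernel-checked here): `le_antisymm` of g18's UPPER headline
`KolyvaginPairSupplyTwo.card_primaryComponent_sha_two_baseChange_le_pow_of_printedInputs` (certificate-free) and this seat's LOWER (L2). -/
theorem cmKolyvaginExactAtInertTwoPrimeDeep'OfFacts_proof : CMKolyvaginExactAtInertTwoPrimeDeep'OfFacts := by
  rintro ⟨hGZ, hGZK, hmod, hMi⟩ W _ _ _ hCM hin hρ hT K _ _ hK hodd h3 hq hH h372 hs1 hs2 Dt β ι d₁ hy M₀ hdiv hndiv n d hn hKoly hPn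
  exact le_antisymm
    (KolyvaginPairSupplyTwo.card_primaryComponent_sha_two_baseChange_le_pow_of_printedInputs W hGZ hGZK hmod hMi hCM hin hρ hT hK
      hodd h3 hH hq h372 Dt β ι d₁ hy M₀ hdiv hndiv)
    (cmKolyvaginLowerAtInertTwoPrimeDeep'OfFacts_proof ⟨hGZ, hGZK, hmod, hMi⟩ W hCM hin hρ hT K hK hodd h3 hq hH h372 hs1 hs2 Dt β ι
      d₁ hy M₀ hdiv hndiv n d hn hKoly hPn)

/-! ## v2 (L0): the REGISTERED certificate — no restatement -/

/-- PROPOSED aside text (L0): crux 24277 VERBATIM with `Nat.Prime |d_K|` and Gross 1991 Prop. 3.7 (2) by name inserted after the Heegner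
hypothesis; conclusion the `≥` half.  Habitat H₂ ∩ {|d_K| prime} (= Σ ≤ 1 on `Δ < 0`). -/
def CMKolyvaginLowerAtInertTwoPrime : Prop :=
  ∀ (W : WeierstrassCurve ℚ) [W.IsElliptic] [W.IsGloballyMinimal] [NeZero (W.conductorNorm ℤ)], W.HasCM → Literature.NumberTheory.EllipticCurves.Rank1Residual.CMInert W 2 → W.HasSurjectiveModNGaloisRep (2 : ℤ) → Odd W.tamagawaProduct → ∀ (K : Type) [Field K] [NumberField K], Literature.NumberTheory.EllipticCurves.IsImaginaryQuadratic K → Odd (NumberField.discr K) → NumberField.discr K ≠ -3 → Nat.Prime (NumberField.discr K).natAbs → Literature.NumberTheory.EllipticCurves.SatisfiesHeegnerHypothesis (W.conductorNorm ℤ) K → Literature.NumberTheory.EllipticCurves.GrossLMS1991.prop37_2_reductionCongruence_inert (W.conductorNorm ℤ) W K → ¬ IsSquare ((NumberField.discr K : ℚ) * -|W.Δ|) → ¬ IsSquare ((NumberField.discr K : ℚ) * (-(2 * |W.Δ|))) → ∀ (Dt : Literature.NumberTheory.EllipticCurves.ModularForms.ModularParametrizationData W (W.conductorNorm ℤ))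 (β : ℤ) (ι : K →+* ℂ) (d₁ : Literature.NumberTheory.EllipticCurves.KolyvaginHeegnerData Dt β ι 1), ¬ IsOfFinAddOrder d₁.derivedPoint → ∀ (M₀ : ℕ), (∃ Q : (W.baseChange (Literature.NumberTheory.EllipticCurves.ringClassField K ι 1)).toAffine.Point, ((2 ^ M₀ : ℕ) : ℤ) • Q = d₁.derivedPoint) → (¬ ∃ Q : (W.baseChange (Literature.NumberTheory.EllipticCurves.ringClassField K ι 1)).toAffine.Point, ((2 ^ (M₀ + 1) : ℕ) : ℤ) • Q = d₁.derivedPoint) → ∀ (n : ℕ) (d : Literature.NumberTheory.EllipticCurves.KolyvaginHeegnerData Dt β ι n), Squarefree n → (∀ ℓ ∈ n.primeFactors, (Literature.NumberTheory.EllipticCurves.Zhang2014.IsKolyvaginPrime (W.conductorNorm ℤ) W K 2 ℓ ∧ Literature.NumberTheory.EllipticCurves.Rank1Residual.CMInert W ℓ)) → (¬ ∃ Q : (W.baseChange (Literature.NumberTheory.EllipticCurves.ringClassField K ι n)).toAffine.Point, (2 : ℤ) • Q = d.derivedPoint) → 2 ^ (2 * M₀) ≤ Nat.card (AddCommGroup.primaryComponent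 (W.baseChange K).sha 2)

/-- `…OfFacts` twin of (L0) on the route's four published inputs (items 24148, 19921, 19273, 24149). -/
def CMKolyvaginLowerAtInertTwoPrimeOfFacts : Prop :=
  ((∀ (N : ℕ) [NeZero N] (W : WeierstrassCurve ℚ) (K : Type) [Field K] [NumberField K],
      Literature.NumberTheory.EllipticCurves.gross_zagier N W K) ∧
    Literature.NumberTheory.EllipticCurves.rank_eq_analyticRank_of_analyticRank_le_one ∧
    WeierstrassCurve.hasEntireLFunction_rat ∧
    Literature.NumberTheory.EllipticCurves.Milne1972.bsdQuotient_baseChange_quadratic_anyModel) →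
  CMKolyvaginLowerAtInertTwoPrime

/-- THE CLOSER of (L0) (kernel-checked here): by this seat's W-UP on H₂ (`KolyvaginLowerTwo.stub_lower_of_prime_of_printedInputs`). -/
theorem cmKolyvaginLowerAtInertTwoPrimeOfFacts_proof : CMKolyvaginLowerAtInertTwoPrimeOfFacts := by
  rintro ⟨hGZ, hGZK, hmod, hMi⟩ W _ _ _ hCM hin hρ hT K _ _ hK hodd h3 hq hH h372 hs1 hs2 Dt β ι d₁ hy M₀ hdiv hndiv n d hn hKoly hPn
  exact KolyvaginLowerTwo.stub_lower_of_prime_of_printedInputs W hCM hin hρ hT K hK hodd h3 hH hs1 hs2 Dt β ι d₁ hy M₀ hdiv hndiv n d hn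
    hKoly hPn hq h372 hGZ hGZK hmod hMi

/-- PROPOSED exactness aside (L0-EXACT): crux 24277 VERBATIM with `Nat.Prime |d_K|` + Gross 3.7 (2) by name inserted; conclusion `=`.
This is the strongest honest booking: 24277 itself on H₂ ∩ {|d_K| prime}, modulo the four prints and `prop37_2`. -/
def CMKolyvaginExactAtInertTwoPrime : Prop :=
  ∀ (W : WeierstrassCurve ℚ) [W.IsElliptic] [W.IsGloballyMinimal] [NeZero (W.conductorNorm ℤ)], W.HasCM → Literature.NumberTheory.EllipticCurves.Rank1Residual.CMInert W 2 → W.HasSurjectiveModNGaloisRep (2 : ℤ) → Odd W.tamagawaProduct → ∀ (K : Type) [Field K] [NumberField K], Literature.NumberTheory.EllipticCurves.IsImaginaryQuadratic K → Odd (NumberField.discr K) → NumberField.discr K ≠ -3 → Nat.Prime (NumberField.discr K).natAbs → Literature.NumberTheory.EllipticCurves.SatisfiesHeegnerHypothesis (W.conductorNorm ℤ) K → Literature.NumberTheory.EllipticCurves.GrossLMS1991.prop37_2_reductionCongruence_inert (W.conductorNorm ℤ) W K → ¬ IsSquare ((NumberField.discr K : ℚ) * -|W.Δ|) → ¬ IsSquare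 ((NumberField.discr K : ℚ) * (-(2 * |W.Δ|))) → ∀ (Dt : Literature.NumberTheory.EllipticCurves.ModularForms.ModularParametrizationData W (W.conductorNorm ℤ)) (β : ℤ) (ι : K →+* ℂ) (d₁ : Literature.NumberTheory.EllipticCurves.KolyvaginHeegnerData Dt β ι 1), ¬ IsOfFinAddOrder d₁.derivedPoint → ∀ (M₀ : ℕ), (∃ Q : (W.baseChange (Literature.NumberTheory.EllipticCurves.ringClassField K ι 1)).toAffine.Point, ((2 ^ M₀ : ℕ) : ℤ) • Q = d₁.derivedPoint) → (¬ ∃ Q : (W.baseChange (Literature.NumberTheory.EllipticCurves.ringClassField K ι 1)).toAffine.Point, ((2 ^ (M₀ + 1) : ℕ) : ℤ) • Q = d₁.derivedPoint) → ∀ (n : ℕ) (d : Literature.NumberTheory.EllipticCurves.KolyvaginHeegnerData Dt β ι n), Squarefree n → (∀ ℓ ∈ n.primeFactors, (Literature.NumberTheory.EllipticCurves.Zhang2014.IsKolyvaginPrime (W.conductorNorm ℤ) W K 2 ℓ ∧ Literature.NumberTheory.EllipticCurves.Rank1Residual.CMInert W ℓ)) → (¬ ∃ Q : (W.baseChange (Literature.NumberTheory.EllipticCurves.ringClassField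 K ι n)).toAffine.Point, (2 : ℤ) • Q = d.derivedPoint) → Nat.card (AddCommGroup.primaryComponent (W.baseChange K).sha 2) = 2 ^ (2 * M₀)

/-- `…OfFacts` twin of (L0-EXACT). -/
def CMKolyvaginExactAtInertTwoPrimeOfFacts : Prop :=
  ((∀ (N : ℕ) [NeZero N] (W : WeierstrassCurve ℚ) (K : Type) [Field K] [NumberField K],
      Literature.NumberTheory.EllipticCurves.gross_zagier N W K) ∧
    Literature.NumberTheory.EllipticCurves.rank_eq_analyticRank_of_analyticRank_le_one ∧
    WeierstrassCurve.hasEntireLFunction_rat ∧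
    Literature.NumberTheory.EllipticCurves.Milne1972.bsdQuotient_baseChange_quadratic_anyModel) →
  CMKolyvaginExactAtInertTwoPrime

/-- THE CLOSER of (L0-EXACT) (kernel-checked here): `le_antisymm` of g18's UPPER headline and this seat's LOWER (L0). -/
theorem cmKolyvaginExactAtInertTwoPrimeOfFacts_proof : CMKolyvaginExactAtInertTwoPrimeOfFacts := by
  rintro ⟨hGZ, hGZK, hmod, hMi⟩ W _ _ _ hCM hin hρ hT K _ _ hK hodd h3 hq hH h372 hs1 hs2 Dt β ι d₁ hy M₀ hdiv hndiv n d hn hKoly hPn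
  exact le_antisymm
    (KolyvaginPairSupplyTwo.card_primaryComponent_sha_two_baseChange_le_pow_of_printedInputs W hGZ hGZK hmod hMi hCM hin hρ hT hK
      hodd h3 hH hq h372 Dt β ι d₁ hy M₀ hdiv hndiv)
    (KolyvaginLowerTwo.stub_lower_of_prime_of_printedInputs W hCM hin hρ hT K hK hodd h3 hH hs1 hs2 Dt β ι d₁ hy M₀ hdiv hndiv n d hn
      hKoly hPn hq h372 hGZ hGZK hmod hMi)

/-- Sanity: the registered `stub_lower` follows from (L0) plus `Nat.Prime |d_K|` and Gross 3.7 (2) by name (trivial reshuffle). -/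
theorem stub_lower_of_L0 (hA : CMKolyvaginLowerAtInertTwoPrime) :
    ∀ (W : WeierstrassCurve ℚ) [W.IsElliptic] [W.IsGloballyMinimal] [NeZero (W.conductorNorm ℤ)], W.HasCM → Literature.NumberTheory.EllipticCurves.Rank1Residual.CMInert W 2 → W.HasSurjectiveModNGaloisRep (2 : ℤ) → Odd W.tamagawaProduct → ∀ (K : Type) [Field K] [NumberField K], Literature.NumberTheory.EllipticCurves.IsImaginaryQuadratic K → Odd (NumberField.discr K) → NumberField.discr K ≠ -3 → Literature.NumberTheory.EllipticCurves.SatisfiesHeegnerHypothesis (W.conductorNorm ℤ) K → ¬ IsSquare ((NumberField.discr K : ℚ) * -|W.Δ|) → ¬ IsSquare ((NumberField.discr K : ℚ) * (-(2 * |W.Δ|))) → ∀ (Dt : Literature.NumberTheory.EllipticCurves.ModularForms.ModularParametrizationData W (W.conductorNorm ℤ)) (β : ℤ) (ι : K →+* ℂ) (d₁ : Literature.NumberTheory.EllipticCurves.KolyvaginHeegnerData Dt β ι 1), ¬ IsOfFinAddOrder d₁.derivedPoint → ∀ (M₀ : ℕ), (∃ Q : (W.baseChange (Literature.NumberTheory.EllipticCurves.ringClassField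 K ι 1)).toAffine.Point, ((2 ^ M₀ : ℕ) : ℤ) • Q = d₁.derivedPoint) → (¬ ∃ Q : (W.baseChange (Literature.NumberTheory.EllipticCurves.ringClassField K ι 1)).toAffine.Point, ((2 ^ (M₀ + 1) : ℕ) : ℤ) • Q = d₁.derivedPoint) → ∀ (n : ℕ) (d : Literature.NumberTheory.EllipticCurves.KolyvaginHeegnerData Dt β ι n), Squarefree n → (∀ ℓ ∈ n.primeFactors, (Literature.NumberTheory.EllipticCurves.Zhang2014.IsKolyvaginPrime (W.conductorNorm ℤ) W K 2 ℓ ∧ Literature.NumberTheory.EllipticCurves.Rank1Residual.CMInert W ℓ)) → (¬ ∃ Q : (W.baseChange (Literature.NumberTheory.EllipticCurves.ringClassField K ι n)).toAffine.Point, (2 : ℤ) • Q = d.derivedPoint) →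
      Nat.Prime (NumberField.discr K).natAbs →
      Literature.NumberTheory.EllipticCurves.GrossLMS1991.prop37_2_reductionCongruence_inert (W.conductorNorm ℤ) W K →
      2 ^ (2 * M₀) ≤ Nat.card (AddCommGroup.primaryComponent (W.baseChange K).sha 2) := by
  intro W _ _ _ hCM hin hρ hT K _ _ hK hodd h3 hH hs1 hs2 Dt β ι d₁ hy M₀ hdiv hndiv n d hn hKol hPn hq h372
  exact hA W hCM hin hρ hT K hK hodd h3 hq hH h372 hs1 hs2 Dt β ι d₁ hy M₀ hdiv hndiv n d hn hKol hPn

end Scratch.CMKolyvaginAtInertTwoEdit24277Lower
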